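import Summits.ResolutionOfSingularities.ResolutionOfSingularities.Theorems.EquisingularLiftEquisingularLiftNatHilbertBurchLift
import Summits.ResolutionOfSingularities.ResolutionOfSingularities.Theorems.EquisingularLiftEquisingularLiftNatDeltaConeLift
import Mathlib
import HarnessLib

/-!
# [OURS · L1 W4.5(b)] HILBERT–BURCH, PART 5 — GRADED BOOKKEEPING: homogeneous Hilbert–Burch matrices have homogeneous
# maximal minors, and lift along a surjection of coefficient rings to homogeneous matrices with minors OF THE SAME DEGREES
# reducing to the given ones (rung v6′ «DET-nose», input brick for res-type-097's T-DET-PROJ (B))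
# (crux `EquisingularLiftNatThree` = stmt-ResolutionOfSingularities-20148, parent stmt-20038, line `sections`)

NOT a statement of any manuscript. Helper file of the chain res-L1-w45b (cell `res-hironaka`, rung L, slot W4.5(b));
AI-written, weaker than expert review; filed `--supports stmt-ResolutionOfSingularities-20148 --as helper`.

WHERE IT SITS: res-type-097's determinantal-nose assembly `DetLift.isRegular_and_flat_detNose` (T-DET-PROJ part 2,
PATH-ANNOUNCE 2026-08-27T10:16:58Z) takes as DATA a lifted matrix `Mt` over `O[x₀,…,xₙ]` with `map π (Mt a b) = M a b`
and its row-deleted maximal minors `Δt l ∈ 𝒜_O (D l)` homogeneous. This file PRODUCES that data from a downstairs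
matrix `M` over `k[x₀,…,xₙ]` with HOMOGENEOUS ENTRIES of row/column-consistent degrees `M i j ∈ 𝒜_k (a i + b j)`
(the shape of a graded Hilbert–Burch matrix):
* `isHomogeneous_det_of_row_add_col` — a square matrix of forms `X i j ∈ 𝒜 (a i + b j)` has `det X ∈ 𝒜 (∑ a + ∑ b)`
  (generalises the tree's `isHomogeneous_det_of_rows`);
* `isHomogeneous_det_submatrix_succAbove` — hence `Δ_l(M) = det (M minus row l) ∈ 𝒜 (∑_{i ≠ l} a i + ∑ b)`, written
  `∑ i, a (l.succAbove i) + ∑ j, b j`; `degree_rowMinor_add` — the bookkeeping `a l + that = ∑ a + ∑ b`;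
* `isHomogeneous_span_minor` — `I_t(M) = span (range Δ)` is a homogeneous ideal (the `⟨span (range Δ), _⟩` argument of
  `projIdealSheaf`; the `GradedRing` structure is a binder — callers have `MvPolynomial.gradedAlgebra` as a local instance);
* `exists_matrix_isHomogeneous_map_eq` — along a surjective `π : R ↠ S`, a matrix of forms over `S[x_σ]` lifts ENTRYWISE to
  a matrix of forms of the same degrees over `R[x_σ]` (T-ΔLIFT's `exists_isHomogeneous_map_eq_of_surjective`, p516044);
* **`exists_homogeneous_lift_rowMinors`** — ONE CALL: given `M` over `S[x_σ]` with `M i j ∈ 𝒜 (a i + b j)` there is `Mt`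
  over `R[x_σ]` with `map π (Mt i j) = M i j`, `Mt i j ∈ 𝒜 (a i + b j)`, every `Δ_l(Mt)` homogeneous of degree
  `∑ i, a (l.succAbove i) + ∑ j, b j` and `map π (Δ_l Mt) = Δ_l M` (part 2 `det_submatrix_map`, p520740).
MATHEMATICAL NOTE (for the TARGET-DETNOSE pen): homogeneity of the downstairs MINORS alone does not make an arbitrary
entrywise lift have homogeneous minors; the entry-degree table `(a, b)` (always available for a graded Hilbert–Burch
matrix) is what makes the lift canonical.

References: D. Eisenbud, GTM 150, §20.4 (graded Hilbert–Burch); proofs elementary. res-type-097 T-DET-PROJ texts (OURS,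
index only).
-/

set_option linter.dupNamespace false -- mandated namespace `Summit.<Summit>.<Problem>` of this single-conjunct summit

namespace Summit.ResolutionOfSingularities.ResolutionOfSingularities.Cruxes.EquisingularLiftNat.Sections

open Matrix MvPolynomial

universe u v w

section Homogeneous

variable {R : Type u} [CommRing R] {σ : Type w}

/-- **Determinants of bihomogeneous matrices are forms.** If `X i j` is homogeneous of degree `a i + b j` then `det X`
is homogeneous of degree `∑ a + ∑ b` (each permutation monomial has that degree). [folklore; cf. tree
`DeterminantalHypersurfaces.isHomogeneous_det_of_rows`] [OURS · L1 W4.5b] -/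
theorem isHomogeneous_det_of_row_add_col {ι : Type*} [Fintype ι] [DecidableEq ι]
    {X : Matrix ι ι (MvPolynomial σ R)} {a b : ι → ℕ} (h : ∀ i j, (X i j).IsHomogeneous (a i + b j)) :
    X.det.IsHomogeneous (∑ i, a i + ∑ i, b i) := by
  rw [Matrix.det_apply]
  refine IsHomogeneous.sum _ _ _ fun τ _ => ?_
  have hp : (∏ i, X (τ i) i).IsHomogeneous (∑ i, a i + ∑ i, b i) := by
    have := IsHomogeneous.prod Finset.univ (fun i => X (τ i) i) (fun i => a (τ i) + b i) (fun i _ => h _ _)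
    rwa [Finset.sum_add_distrib, Equiv.sum_comp τ a] at this
  rw [Units.smul_def]
  exact (mem_homogeneousSubmodule _ _).mp (zsmul_mem ((mem_homogeneousSubmodule _ _).mpr hp) _)

variable {t : ℕ}

/-- **Maximal minors of a graded Hilbert–Burch matrix are forms**: for `M : (t+1) × t` with `M i j` homogeneous of degree
`a i + b j`, the row-deleted minor `Δ_l(M) = det (M.submatrix l.succAbove id)` is homogeneous of degree
`∑ i, a (l.succAbove i) + ∑ j, b j`. [folklore] [OURS · L1 W4.5b] -/
theorem isHomogeneous_det_submatrix_succAbove (M : Matrix (Fin (t + 1)) (Fin t) (MvPolynomial σ R)) {a : Fin (t + 1) → ℕ}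
    {b : Fin t → ℕ} (h : ∀ i j, (M i j).IsHomogeneous (a i + b j)) (l : Fin (t + 1)) :
    (M.submatrix l.succAbove id).det.IsHomogeneous (∑ i, a (l.succAbove i) + ∑ j, b j) :=
  isHomogeneous_det_of_row_add_col (X := M.submatrix l.succAbove id) (a := fun i => a (l.succAbove i)) (b := b)
    fun i j => by simpa only [Matrix.submatrix_apply, id] using h (l.succAbove i) j

/-- Degree bookkeeping: `a l + (∑ i, a (l.succAbove i) + ∑ j, b j) = ∑ i, a i + ∑ j, b j`. [folklore] [OURS · L1 W4.5b] -/
theorem degree_rowMinor_add (a : Fin (t + 1) → ℕ) (b : Fin t → ℕ) (l : Fin (t + 1)) :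
    a l + (∑ i, a (l.succAbove i) + ∑ j, b j) = ∑ i, a i + ∑ j, b j := by
  rw [← add_assoc, ← Fin.sum_univ_succAbove a l]

/-- Membership form: `Δ_l(M) ∈ 𝒜 (∑ i, a (l.succAbove i) + ∑ j, b j)` for the grading `𝒜 = homogeneousSubmodule σ R`.
[folklore] [OURS · L1 W4.5b] -/
theorem det_submatrix_succAbove_mem_homogeneousSubmodule (M : Matrix (Fin (t + 1)) (Fin t) (MvPolynomial σ R))
    {a : Fin (t + 1) → ℕ} {b : Fin t → ℕ} (h : ∀ i j, M i j ∈ homogeneousSubmodule σ R (a i + b j))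
    (l : Fin (t + 1)) :
    (M.submatrix l.succAbove id).det ∈ homogeneousSubmodule σ R (∑ i, a (l.succAbove i) + ∑ j, b j) :=
  (mem_homogeneousSubmodule _ _).mpr
    (isHomogeneous_det_submatrix_succAbove M (fun i j => (mem_homogeneousSubmodule _ _).mp (h i j)) l)

/-- **The ideal of maximal minors of a graded Hilbert–Burch matrix is homogeneous.** Stated for ANY `GradedRing`
structure on the standard grading `homogeneousSubmodule σ R` supplied by the caller (the chain's Proj files use
`attribute [local instance] MvPolynomial.gradedAlgebra`; no instance is declared here). [folklore] [OURS · L1 W4.5b] -/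
theorem isHomogeneous_span_minor [GradedRing (homogeneousSubmodule σ R)]
    (M : Matrix (Fin (t + 1)) (Fin t) (MvPolynomial σ R)) {a : Fin (t + 1) → ℕ}
    {b : Fin t → ℕ} (h : ∀ i j, (M i j).IsHomogeneous (a i + b j)) :
    (Ideal.span (Set.range fun l : Fin (t + 1) => (M.submatrix l.succAbove id).det)).IsHomogeneous
      (homogeneousSubmodule σ R) := by
  refine Ideal.homogeneous_span _ _ ?_
  rintro x ⟨l, rfl⟩
  exact ⟨_, (mem_homogeneousSubmodule _ _).mpr (isHomogeneous_det_submatrix_succAbove M h l)⟩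

variable {S : Type v} [CommRing S]

/-- **Matrices of forms lift to matrices of forms** along a surjective map of coefficient rings, entry by entry, keeping
every degree. [folklore] [OURS · L1 W4.5b] -/
theorem exists_matrix_isHomogeneous_map_eq (π : R →+* S) (hπ : Function.Surjective π) {m n : Type*}
    (N : Matrix m n (MvPolynomial σ S)) (e : m → n → ℕ) (hN : ∀ i j, (N i j).IsHomogeneous (e i j)) :
    ∃ M : Matrix m n (MvPolynomial σ R), M.map (MvPolynomial.map π) = N ∧ ∀ i j, (M i j).IsHomogeneous (e i j) := by
  have h : ∀ i j, ∃ G : MvPolynomial σ R, G.IsHomogeneous (e i j) ∧ MvPolynomial.map π G = N i j :=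
    fun i j => exists_isHomogeneous_map_eq_of_surjective π hπ (N i j) (hN i j)
  choose G hG using h
  exact ⟨fun i j => G i j, Matrix.ext fun i j => (hG i j).2, fun i j => (hG i j).1⟩

/-- **ONE-CALL HOMOGENEOUS HILBERT–BURCH LIFT.** `π : R ↠ S` surjective, `M : (t+1) × t` over `S[x_σ]` with entries
homogeneous of degrees `a i + b j`. Then there is `Mt` over `R[x_σ]` with: `map π (Mt i j) = M i j` for all `i j`; the
entries `Mt i j` homogeneous of degree `a i + b j`; every row-deleted maximal minor `Δ_l(Mt)` homogeneous of degree
`∑ i, a (l.succAbove i) + ∑ j, b j`; and `map π (Δ_l Mt) = Δ_l M`. This is the data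
`(Mt, hMtM, Δt := Δ(Mt), hΔt)` of res-type-097's `DetLift.isRegular_and_flat_detNose`, produced from the downstairs graded
matrix. [folklore] [OURS · L1 W4.5b] -/
theorem exists_homogeneous_lift_rowMinors (π : R →+* S) (hπ : Function.Surjective π)
    (M : Matrix (Fin (t + 1)) (Fin t) (MvPolynomial σ S)) (a : Fin (t + 1) → ℕ) (b : Fin t → ℕ)
    (hM : ∀ i j, (M i j).IsHomogeneous (a i + b j)) :
    ∃ Mt : Matrix (Fin (t + 1)) (Fin t) (MvPolynomial σ R),
      (∀ i j, MvPolynomial.map π (Mt i j) = M i j) ∧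
      (∀ i j, (Mt i j).IsHomogeneous (a i + b j)) ∧
      (∀ l : Fin (t + 1),
        (Mt.submatrix l.succAbove id).det.IsHomogeneous (∑ i, a (l.succAbove i) + ∑ j, b j)) ∧
      ∀ l : Fin (t + 1),
        MvPolynomial.map π (Mt.submatrix l.succAbove id).det = (M.submatrix l.succAbove id).det := by
  obtain ⟨Mt, hMt, hhom⟩ := exists_matrix_isHomogeneous_map_eq π hπ M (fun i j => a i + b j) hM
  refine ⟨Mt, fun i j => ?_, hhom, fun l => isHomogeneous_det_submatrix_succAbove Mt hhom l, fun l => ?_⟩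
  · rw [← hMt]; rfl
  · rw [← det_submatrix_map (MvPolynomial.map π) Mt l, hMt]

/-- The same with the minors' degrees stated as `D l` where `a l + D l = ∑ a + ∑ b` — the form in which a consumer who
knows the total degree `∑ a + ∑ b` reads off `D`. [folklore] [OURS · L1 W4.5b] -/
theorem exists_homogeneous_lift_rowMinors' (π : R →+* S) (hπ : Function.Surjective π)
    (M : Matrix (Fin (t + 1)) (Fin t) (MvPolynomial σ S)) (a : Fin (t + 1) → ℕ) (b : Fin t → ℕ)
    (hM : ∀ i j, (M i j).IsHomogeneous (a i + b j)) (D : Fin (t + 1) → ℕ)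
    (hD : ∀ l, a l + D l = ∑ i, a i + ∑ j, b j) :
    ∃ Mt : Matrix (Fin (t + 1)) (Fin t) (MvPolynomial σ R),
      (∀ i j, MvPolynomial.map π (Mt i j) = M i j) ∧
      (∀ l : Fin (t + 1), (Mt.submatrix l.succAbove id).det ∈ homogeneousSubmodule σ R (D l)) ∧
      (∀ l : Fin (t + 1), (M.submatrix l.succAbove id).det ∈ homogeneousSubmodule σ S (D l)) ∧
      ∀ l : Fin (t + 1),
        MvPolynomial.map π (Mt.submatrix l.succAbove id).det = (M.submatrix l.succAbove id).det := by
  obtain ⟨Mt, hMt, hhom, hmin, hred⟩ := exists_homogeneous_lift_rowMinors π hπ M a b hM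
  have hD' : ∀ l, D l = ∑ i, a (l.succAbove i) + ∑ j, b j := by
    intro l
    have h1 := hD l
    rw [← degree_rowMinor_add a b l] at h1
    omega
  refine ⟨Mt, hMt, fun l => ?_, fun l => ?_, hred⟩
  · rw [hD', mem_homogeneousSubmodule]; exact hmin l
  · rw [hD', mem_homogeneousSubmodule]; exact isHomogeneous_det_submatrix_succAbove M hM l

end Homogeneous

end Summit.ResolutionOfSingularities.ResolutionOfSingularities.Cruxes.EquisingularLiftNat.Sections
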